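import Summits.AtomisticToContinuum.FouriersLaw.Theorems.BondHeatUncertaintySubdiffusiveBondHeatLocalEnergyMoment

/-!
# `SubdiffusiveBondHeat` · tools for the SCALING-COVARIANT statics `E_{μ_T^N}[e₀²] ≤ b·T²` (decomp-a2c hand-2 g19, critic row 691 (b) box)

The covariant rung `CovariantCorrectorCeiling` of the `KineticCorrectorBudget` ladder (`…AnharmonicityWindowLadder`, lens-1 g54) is hand-1's affine
chain (`…AffineCorrectorCeiling.affineCorrectorCeiling_two`, `B = 4σ²/γ²`) plus ONE static input uniform in the temperature: a bound
`E_{μ_T^N}[e₀²] ≤ b·T²` with `b = b(ω₂, lam, β)` for ALL `T > 0`, `N ≥ 2` (lens-1 g55 EXCERPT §4).  The tree's `localEnergyMoment` gives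
`σ²(T) = 3T²/2 + 2A(1 + 2C(T))`, which is not `O(T²)` (the `1 +` and the one-site eighth moment `C(T)`).  This file supplies the `T`-covariant
replacements of the position moments:

* §1 a GENERIC transport lemma `pinnedChain_integrable_and_fn_moment_le` (the tree's `pinnedChain_integrable_and_moment_le` with `q_i⁸`
  replaced by `h(q_i)` for a continuous `h ≥ 0`);
* §2 one-site weights: scaling of Lebesgue lower integrals on `ℝ`, finiteness / positivity of the Gaussian weight `e^{−c a²}` with `a⁴` and of
  the quartic weight `e^{−c a⁴}` with `a⁸`, and the SCALING IDENTITIES `∫ a⁴e^{−ca²} · ∫ e^{−a²} = c^{−5/2}…`-type in the form of the two RATIO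
  identities `M₄(c) = c⁻² · M₄(1)`, `M₈(c) = c⁻² · M₈(1)` (`M_k(c) = (∫ a^k w_c) / (∫ w_c)`, as real numbers);
* §3 the two CHEBYSHEV reweightings at one site (`…Rearrangement.chebyshev_lintegral`): dropping the factor `e^{−lam a⁴/(4T)}` of `e^{−U/T}`
  can only increase the fourth moment (⇒ Gaussian weight `c = ω₂/(2T)`), dropping `e^{−ω₂a²/(2T)}` can only increase the eighth moment (⇒ quartic
  weight `c = lam/(4T)`), each combined with the chain-to-one-site step `lintegral_coord_zero/one_mul_le` into the hypothesis `hq` of §1.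
[folklore]; 0 sorry; no definitions.  `--supports stmt-AtomisticToContinuum-9120`.
-/

noncomputable section

open MeasureTheory Set
open scoped ENNReal

namespace Summit.AtomisticToContinuum.FouriersLaw.Theorems.SubdiffusiveBondHeat

open Literature.MathematicalPhysics.KineticTheory.HeatConduction

/-! ## §1. Transport of a one-site bound to the Gibbs state, for a general nonnegative continuous `h` -/

/-- **Generic transport.** If `(∫ h(q_i) e^{-Φ_N/T} dq)·B ≤ A·∫ e^{-Φ_N/T} dq` with `A < ∞`, `0 < B < ∞`, `h ≥ 0` continuous, then
`h(q_i)` is `μ_T^N`-integrable and `∫ h(q_i) dμ_T^N ≤ A/B` (the tree's `pinnedChain_integrable_and_moment_le`, verbatim with `q_i⁸ ↦ h(q_i)`).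
[folklore] -/
theorem pinnedChain_integrable_and_fn_moment_le {ω₂ lam β : ℝ} (hω : 0 < ω₂) (hl : 0 ≤ lam)
    (hβ : 0 ≤ β) (γ : ℝ) {T : ℝ} (hT : 0 < T) {N : ℕ} (i : Fin N) {h : ℝ → ℝ} (hhc : Continuous h) (hh0 : ∀ x, 0 ≤ h x)
    {A B : ℝ≥0∞} (hA : A ≠ ⊤) (hB0 : B ≠ 0) (hB : B ≠ ⊤)
    (hq : (∫⁻ q : Fin N → ℝ, ENNReal.ofReal (h (q i)) *
        ENNReal.ofReal (Real.exp (-(pinnedChain ω₂ lam β γ).potential N q / T))) * B ≤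
      A * ∫⁻ q : Fin N → ℝ, ENNReal.ofReal (Real.exp (-(pinnedChain ω₂ lam β γ).potential N q / T))) :
    Integrable (fun z : PhaseSpace N => h (z.1 i)) ((pinnedChain ω₂ lam β γ).gibbsMeasure N T) ∧
      ∫ z, h (z.1 i) ∂((pinnedChain ω₂ lam β γ).gibbsMeasure N T) ≤ A.toReal / B.toReal := by
  set P := pinnedChain ω₂ lam β γ with hP
  have hUc : Continuous P.U := (pinnedChain_contDiff_U ω₂ lam β γ (n := 0)).continuous
  have hVc : Continuous P.V := (pinnedChain_contDiff_V ω₂ lam β γ (n := 0)).continuous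
  have hΦ : Measurable (P.potential N) := (continuous_potential P hUc hVc N).measurable
  have hρc : Continuous (P.gibbsDensity N T) := pinnedChain_continuous_gibbsDensity ω₂ lam β γ N T
  have hhm : Measurable h := hhc.measurable
  have hKc : Continuous fun p : Fin N → ℝ => Real.exp (-(∑ j, p j ^ 2 / 2) / T) := by fun_prop
  set K : ℝ≥0∞ := ∫⁻ p : Fin N → ℝ, ENNReal.ofReal (Real.exp (-(∑ j, p j ^ 2 / 2) / T)) with hK
  have hρ : ∀ z : PhaseSpace N, P.gibbsDensity N T z =
      Real.exp (-P.potential N z.1 / T) * Real.exp (-(∑ j, z.2 j ^ 2 / 2) / T) := by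
    intro z
    rw [OscillatorChain.gibbsDensity, P.hamiltonian_eq_kinetic_add_potential, ← Real.exp_add]
    congr 1
    ring
  have hm1 : Measurable fun q : Fin N → ℝ => ENNReal.ofReal (h (q i)) * ENNReal.ofReal (Real.exp (-P.potential N q / T)) :=
    ((hhm.comp (measurable_pi_apply i)).ennreal_ofReal).mul (by fun_prop)
  have hI : ∫⁻ z : PhaseSpace N, ENNReal.ofReal (h (z.1 i) * P.gibbsDensity N T z) =
      (∫⁻ q : Fin N → ℝ, ENNReal.ofReal (h (q i)) *
        ENNReal.ofReal (Real.exp (-P.potential N q / T))) * K := by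
    rw [hK, ← lintegral_prod_mul hm1.aemeasurable hKc.measurable.ennreal_ofReal.aemeasurable]
    refine lintegral_congr fun z => ?_
    rw [hρ, ← mul_assoc, ENNReal.ofReal_mul (mul_nonneg (hh0 _) (by positivity)), ENNReal.ofReal_mul (hh0 _)]
  have hZ : ∫⁻ z : PhaseSpace N, ENNReal.ofReal (P.gibbsDensity N T z) =
      (∫⁻ q : Fin N → ℝ, ENNReal.ofReal (Real.exp (-P.potential N q / T))) * K := by
    rw [hK, ← lintegral_prod_mul (by fun_prop) hKc.measurable.ennreal_ofReal.aemeasurable]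
    refine lintegral_congr fun z => ?_
    rw [hρ, ENNReal.ofReal_mul (by positivity)]
  have key : (∫⁻ z : PhaseSpace N, ENNReal.ofReal (h (z.1 i) * P.gibbsDensity N T z)) * B ≤
      A * ∫⁻ z : PhaseSpace N, ENNReal.ofReal (P.gibbsDensity N T z) := by
    rw [hI, hZ, mul_right_comm, ← mul_assoc]
    exact mul_le_mul_left hq K
  have hρi : Integrable (P.gibbsDensity N T) := pinnedChain_integrable_gibbsDensity hω hl hβ γ N hT
  have hZfin : ∫⁻ z : PhaseSpace N, ENNReal.ofReal (P.gibbsDensity N T z) ≠ ⊤ :=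
    (lintegral_ofReal_ne_top_iff_integrable hρi.aestronglyMeasurable
      (ae_of_all _ fun z => (P.gibbsDensity_pos N T z).le)).mpr hρi
  have hIfin : ∫⁻ z : PhaseSpace N, ENNReal.ofReal (h (z.1 i) * P.gibbsDensity N T z) ≠ ⊤ := by
    intro h'
    rw [h', ENNReal.top_mul hB0] at key
    exact absurd key (not_le.mpr (ENNReal.mul_lt_top hA.lt_top hZfin.lt_top))
  have hc : Continuous fun z : PhaseSpace N => h (z.1 i) * P.gibbsDensity N T z :=
    (hhc.comp ((continuous_apply i).comp continuous_fst)).mul hρc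
  have hnn : ∀ z : PhaseSpace N, 0 ≤ h (z.1 i) * P.gibbsDensity N T z := fun z =>
    mul_nonneg (hh0 _) (P.gibbsDensity_pos N T z).le
  have hInt : Integrable (fun z : PhaseSpace N => h (z.1 i) * P.gibbsDensity N T z) :=
    (lintegral_ofReal_ne_top_iff_integrable hc.aestronglyMeasurable (ae_of_all _ hnn)).mp hIfin
  refine ⟨P.integrable_gibbsMeasure hInt, ?_⟩
  rw [P.integral_gibbsMeasure]
  have hZpos : 0 < ∫ z, P.gibbsDensity N T z := integral_exp_pos hρi
  have e1 : ENNReal.ofReal (∫ z : PhaseSpace N, h (z.1 i) * P.gibbsDensity N T z) =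
      ∫⁻ z : PhaseSpace N, ENNReal.ofReal (h (z.1 i) * P.gibbsDensity N T z) :=
    ofReal_integral_eq_lintegral_ofReal hInt (ae_of_all _ hnn)
  have e2 : ENNReal.ofReal (∫ z, P.gibbsDensity N T z) =
      ∫⁻ z : PhaseSpace N, ENNReal.ofReal (P.gibbsDensity N T z) :=
    ofReal_integral_eq_lintegral_ofReal hρi (ae_of_all _ fun z => (P.gibbsDensity_pos N T z).le)
  have hreal : (∫ z : PhaseSpace N, h (z.1 i) * P.gibbsDensity N T z) * B.toReal ≤
      A.toReal * ∫ z, P.gibbsDensity N T z := by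
    have := ENNReal.toReal_mono (ENNReal.mul_ne_top hA hZfin) key
    rwa [ENNReal.toReal_mul, ENNReal.toReal_mul, ← e1, ← e2,
      ENNReal.toReal_ofReal (integral_nonneg hnn), ENNReal.toReal_ofReal hZpos.le] at this
  have hBpos : 0 < B.toReal := ENNReal.toReal_pos hB0 hB
  rw [inv_mul_le_iff₀ hZpos, mul_div_assoc', le_div_iff₀ hBpos]
  linarith [mul_comm A.toReal (∫ z, P.gibbsDensity N T z)]

/-! ## §2. One-site weights: scaling, finiteness, positivity -/

/-- Scaling of a lower Lebesgue integral on `ℝ`: `∫ f(a·x) dx = |a|⁻¹·∫ f`. [folklore] -/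
theorem lintegral_comp_mul_left_real (f : ℝ → ℝ≥0∞) (hf : Measurable f) {a : ℝ} (ha : a ≠ 0) :
    ∫⁻ x, f (a * x) = ENNReal.ofReal |a⁻¹| * ∫⁻ x, f x := by
  rw [← lintegral_map hf (measurable_const_mul a), Real.map_volume_mul_left ha, lintegral_smul_measure]
  simp

/-- A positive continuous function has a nonzero lower integral. [folklore] -/
theorem lintegral_ofReal_ne_zero_of_pos {g : ℝ → ℝ} (hg : Continuous g) (hpos : ∀ x, 0 < g x) :
    ∫⁻ x, ENNReal.ofReal (g x) ≠ 0 := by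
  refine ((lintegral_pos_iff_support (hg.measurable.ennreal_ofReal)).mpr ?_).ne'
  have hs : Function.support (fun x => ENNReal.ofReal (g x)) = Set.univ := by
    ext x; simp [hpos x]
  rw [hs]; exact isOpen_univ.measure_pos volume Set.univ_nonempty

/-- A continuous nonnegative function dominated by an integrable one has a finite lower integral. [folklore] -/
theorem lintegral_ofReal_ne_top_of_le {f g : ℝ → ℝ} (hf : Continuous f) (hf0 : ∀ x, 0 ≤ f x) (hg : Integrable g)
    (hle : ∀ x, f x ≤ g x) : ∫⁻ x, ENNReal.ofReal (f x) ≠ ⊤ := by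
  refine (lintegral_ofReal_ne_top_iff_integrable hf.aestronglyMeasurable (ae_of_all _ hf0)).mpr ?_
  exact hg.mono' hf.aestronglyMeasurable (ae_of_all _ fun x => by
    rw [Real.norm_eq_abs, abs_of_nonneg (hf0 x)]; exact hle x)

/-- `u² ≤ 2·e^u` for `u ≥ 0`. [folklore] -/
private theorem sq_le_two_mul_exp {u : ℝ} (hu : 0 ≤ u) : u ^ 2 ≤ 2 * Real.exp u := by
  have h := Real.quadratic_le_exp_of_nonneg hu
  nlinarith [Real.exp_pos u]

/-- **Gaussian weight**: `∫ e^{−c a²} da ∈ (0, ∞)` and `∫ a⁴ e^{−c a²} da < ∞` (`c > 0`). [folklore] -/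
theorem gauss_weight_facts {c : ℝ} (hc : 0 < c) :
    (∫⁻ a, ENNReal.ofReal (Real.exp (-c * a ^ 2)) ≠ 0) ∧ (∫⁻ a, ENNReal.ofReal (Real.exp (-c * a ^ 2)) ≠ ⊤) ∧
      (∫⁻ a, ENNReal.ofReal (a ^ 4 * Real.exp (-c * a ^ 2)) ≠ ⊤) := by
  refine ⟨lintegral_ofReal_ne_zero_of_pos (by fun_prop) fun x => Real.exp_pos _,
    lintegral_ofReal_ne_top_of_le (by fun_prop) (fun x => (Real.exp_pos _).le) (integrable_exp_neg_mul_sq hc) fun x => le_rfl, ?_⟩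
  -- `a⁴ e^{−c a²} ≤ (8/c²)·e^{−(c/2) a²}`
  have hc2 : 0 < c / 2 := by linarith
  refine lintegral_ofReal_ne_top_of_le (by fun_prop) (fun x => by positivity)
    ((integrable_exp_neg_mul_sq hc2).const_mul (8 / c ^ 2)) fun x => ?_
  have hu : 0 ≤ c * x ^ 2 / 2 := by positivity
  have h1 := sq_le_two_mul_exp hu
  have e : Real.exp (-c * x ^ 2) = Real.exp (-(c / 2) * x ^ 2) * (Real.exp (c * x ^ 2 / 2))⁻¹ := by
    rw [← Real.exp_neg, ← Real.exp_add]; congr 1; ring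
  rw [e]
  have hE : 0 < Real.exp (c * x ^ 2 / 2) := Real.exp_pos _
  have hG : 0 < Real.exp (-(c / 2) * x ^ 2) := Real.exp_pos _
  rw [show x ^ 4 * (Real.exp (-(c / 2) * x ^ 2) * (Real.exp (c * x ^ 2 / 2))⁻¹) =
      (x ^ 4 / Real.exp (c * x ^ 2 / 2)) * Real.exp (-(c / 2) * x ^ 2) by field_simp]
  refine mul_le_mul_of_nonneg_right ?_ hG.le
  rw [div_le_iff₀ hE]
  have : (c * x ^ 2 / 2) ^ 2 = c ^ 2 / 4 * x ^ 4 := by ring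
  rw [this] at h1
  have hc' : 0 < c ^ 2 := by positivity
  calc x ^ 4 = (4 / c ^ 2) * (c ^ 2 / 4 * x ^ 4) := by field_simp
    _ ≤ (4 / c ^ 2) * (2 * Real.exp (c * x ^ 2 / 2)) := mul_le_mul_of_nonneg_left h1 (by positivity)
    _ = 8 / c ^ 2 * Real.exp (c * x ^ 2 / 2) := by ring

/-- **Quartic weight**: `∫ e^{−c a⁴} da ∈ (0, ∞)` and `∫ a⁸ e^{−c a⁴} da < ∞` (`c > 0`). [folklore] -/
theorem quartic_weight_facts {c : ℝ} (hc : 0 < c) :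
    (∫⁻ a, ENNReal.ofReal (Real.exp (-c * a ^ 4)) ≠ 0) ∧ (∫⁻ a, ENNReal.ofReal (Real.exp (-c * a ^ 4)) ≠ ⊤) ∧
      (∫⁻ a, ENNReal.ofReal (a ^ 8 * Real.exp (-c * a ^ 4)) ≠ ⊤) := by
  -- `e^{−c a⁴} ≤ e^{c}·e^{−2c a²}` since `a⁴ ≥ 2a² − 1`
  have hquart : ∀ (κ : ℝ), 0 < κ → ∀ x : ℝ, Real.exp (-κ * x ^ 4) ≤ Real.exp κ * Real.exp (-(2 * κ) * x ^ 2) := by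
    intro κ hκ x
    rw [← Real.exp_add]
    refine Real.exp_le_exp.mpr ?_
    nlinarith [sq_nonneg (x ^ 2 - 1), hκ.le]
  refine ⟨lintegral_ofReal_ne_zero_of_pos (by fun_prop) fun x => Real.exp_pos _,
    lintegral_ofReal_ne_top_of_le (by fun_prop) (fun x => (Real.exp_pos _).le)
      ((integrable_exp_neg_mul_sq (by linarith : (0:ℝ) < 2 * c)).const_mul (Real.exp c)) (hquart c hc), ?_⟩
  have hc2 : 0 < c / 2 := by linarith
  refine lintegral_ofReal_ne_top_of_le (by fun_prop) (fun x => by positivity)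
    (((integrable_exp_neg_mul_sq (by linarith : (0:ℝ) < 2 * (c / 2))).const_mul (Real.exp (c / 2))).const_mul (8 / c ^ 2))
    fun x => ?_
  have hu : 0 ≤ c * x ^ 4 / 2 := by positivity
  have h1 := sq_le_two_mul_exp hu
  have step1 : x ^ 8 * Real.exp (-c * x ^ 4) ≤ 8 / c ^ 2 * Real.exp (-(c / 2) * x ^ 4) := by
    have e : Real.exp (-c * x ^ 4) = Real.exp (-(c / 2) * x ^ 4) * (Real.exp (c * x ^ 4 / 2))⁻¹ := by
      rw [← Real.exp_neg, ← Real.exp_add]; congr 1; ring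
    rw [e]
    have hE : 0 < Real.exp (c * x ^ 4 / 2) := Real.exp_pos _
    have hG : 0 < Real.exp (-(c / 2) * x ^ 4) := Real.exp_pos _
    rw [show x ^ 8 * (Real.exp (-(c / 2) * x ^ 4) * (Real.exp (c * x ^ 4 / 2))⁻¹) =
        (x ^ 8 / Real.exp (c * x ^ 4 / 2)) * Real.exp (-(c / 2) * x ^ 4) by field_simp]
    refine mul_le_mul_of_nonneg_right ?_ hG.le
    rw [div_le_iff₀ hE]
    have : (c * x ^ 4 / 2) ^ 2 = c ^ 2 / 4 * x ^ 8 := by ring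
    rw [this] at h1
    have hc' : 0 < c ^ 2 := by positivity
    calc x ^ 8 = (4 / c ^ 2) * (c ^ 2 / 4 * x ^ 8) := by field_simp
      _ ≤ (4 / c ^ 2) * (2 * Real.exp (c * x ^ 4 / 2)) := mul_le_mul_of_nonneg_left h1 (by positivity)
      _ = 8 / c ^ 2 * Real.exp (c * x ^ 4 / 2) := by ring
  refine step1.trans ?_
  exact mul_le_mul_of_nonneg_left (hquart (c / 2) hc2 x) (by positivity)

/-- **Scaling of the Gaussian moment ratio**: with `w_c(a) = e^{−c a²}`, `c > 0`,
`(∫ a⁴ w_c)·(∫ w_1) = c^{−2}·(∫ a⁴ w_1)·(∫ w_c)`-type identity in the form used below: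
`∫ a⁴ w_c = ofReal(c^{-5/2}) ∫ a⁴ w_1` and `∫ w_c = ofReal(c^{-1/2}) ∫ w_1` (substitution `a = c^{−1/2} t`). [folklore] -/
theorem gauss_scaling {c : ℝ} (hc : 0 < c) :
    (∫⁻ a, ENNReal.ofReal (a ^ 4 * Real.exp (-c * a ^ 2))) =
        ENNReal.ofReal ((Real.sqrt c)⁻¹ ^ 5) * ∫⁻ t, ENNReal.ofReal (t ^ 4 * Real.exp (-1 * t ^ 2)) ∧
      (∫⁻ a, ENNReal.ofReal (Real.exp (-c * a ^ 2))) =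
        ENNReal.ofReal ((Real.sqrt c)⁻¹) * ∫⁻ t, ENNReal.ofReal (Real.exp (-1 * t ^ 2)) := by
  set κ : ℝ := (Real.sqrt c)⁻¹ with hκ
  have hsc : 0 < Real.sqrt c := Real.sqrt_pos.mpr hc
  have hκ0 : 0 < κ := inv_pos.mpr hsc
  have hκc : c * κ ^ 2 = 1 := by
    rw [hκ, inv_pow, Real.sq_sqrt hc.le]; field_simp
  -- `x = κ t`: `∫ F(x) dx = κ ∫ F(κ t) dt`
  have hsub : ∀ (F : ℝ → ℝ≥0∞), Measurable F → ∫⁻ x, F x = ENNReal.ofReal κ * ∫⁻ t, F (κ * t) := by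
    intro F hF
    rw [lintegral_comp_mul_left_real F hF hκ0.ne', ← mul_assoc, ← ENNReal.ofReal_mul hκ0.le,
      abs_of_pos (inv_pos.mpr hκ0), mul_inv_cancel₀ hκ0.ne', ENNReal.ofReal_one, one_mul]
  constructor
  · rw [hsub _ (by fun_prop)]
    have hpt : ∀ t : ℝ, ENNReal.ofReal ((κ * t) ^ 4 * Real.exp (-c * (κ * t) ^ 2)) =
        ENNReal.ofReal (κ ^ 4) * ENNReal.ofReal (t ^ 4 * Real.exp (-1 * t ^ 2)) := by
      intro t
      rw [← ENNReal.ofReal_mul (by positivity)]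
      congr 1
      rw [show -c * (κ * t) ^ 2 = -(c * κ ^ 2) * t ^ 2 by ring, hκc]
      ring
    simp_rw [hpt]
    rw [lintegral_const_mul' _ _ ENNReal.ofReal_ne_top, ← mul_assoc, ← ENNReal.ofReal_mul hκ0.le]
    congr 2
    ring
  · rw [hsub _ (by fun_prop)]
    congr 1
    refine lintegral_congr fun t => ?_
    rw [show -c * (κ * t) ^ 2 = -(c * κ ^ 2) * t ^ 2 by ring, hκc]

/-- **Scaling of the quartic moment ratio**: `w_c(a) = e^{−c a⁴}`, substitution `a = c^{−1/4} t`: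
`∫ a⁸ w_c = ofReal(κ⁹) ∫ t⁸ w_1`, `∫ w_c = ofReal(κ) ∫ w_1`, `κ = c^{−1/4}`. [folklore] -/
theorem quartic_scaling {c : ℝ} (hc : 0 < c) :
    (∫⁻ a, ENNReal.ofReal (a ^ 8 * Real.exp (-c * a ^ 4))) =
        ENNReal.ofReal ((Real.sqrt (Real.sqrt c))⁻¹ ^ 9) * ∫⁻ t, ENNReal.ofReal (t ^ 8 * Real.exp (-1 * t ^ 4)) ∧
      (∫⁻ a, ENNReal.ofReal (Real.exp (-c * a ^ 4))) =
        ENNReal.ofReal ((Real.sqrt (Real.sqrt c))⁻¹) * ∫⁻ t, ENNReal.ofReal (Real.exp (-1 * t ^ 4)) := by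
  set κ : ℝ := (Real.sqrt (Real.sqrt c))⁻¹ with hκ
  have hsc : 0 < Real.sqrt c := Real.sqrt_pos.mpr hc
  have hssc : 0 < Real.sqrt (Real.sqrt c) := Real.sqrt_pos.mpr hsc
  have hκ0 : 0 < κ := inv_pos.mpr hssc
  have hκc : c * κ ^ 4 = 1 := by
    have h2 : (Real.sqrt (Real.sqrt c)) ^ 2 = Real.sqrt c := Real.sq_sqrt hsc.le
    have h4 : (Real.sqrt (Real.sqrt c)) ^ 4 = c := by
      rw [show (4:ℕ) = 2 * 2 by norm_num, pow_mul, h2, Real.sq_sqrt hc.le]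
    rw [hκ, inv_pow, h4]; field_simp
  have hsub : ∀ (F : ℝ → ℝ≥0∞), Measurable F → ∫⁻ x, F x = ENNReal.ofReal κ * ∫⁻ t, F (κ * t) := by
    intro F hF
    rw [lintegral_comp_mul_left_real F hF hκ0.ne', ← mul_assoc, ← ENNReal.ofReal_mul hκ0.le,
      abs_of_pos (inv_pos.mpr hκ0), mul_inv_cancel₀ hκ0.ne', ENNReal.ofReal_one, one_mul]
  constructor
  · rw [hsub _ (by fun_prop)]
    have hpt : ∀ t : ℝ, ENNReal.ofReal ((κ * t) ^ 8 * Real.exp (-c * (κ * t) ^ 4)) =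
        ENNReal.ofReal (κ ^ 8) * ENNReal.ofReal (t ^ 8 * Real.exp (-1 * t ^ 4)) := by
      intro t
      rw [← ENNReal.ofReal_mul (by positivity)]
      congr 1
      rw [show -c * (κ * t) ^ 4 = -(c * κ ^ 4) * t ^ 4 by ring, hκc]
      ring
    simp_rw [hpt]
    rw [lintegral_const_mul' _ _ ENNReal.ofReal_ne_top, ← mul_assoc, ← ENNReal.ofReal_mul hκ0.le]
    congr 2
    ring
  · rw [hsub _ (by fun_prop)]
    congr 1
    refine lintegral_congr fun t => ?_
    rw [show -c * (κ * t) ^ 4 = -(c * κ ^ 4) * t ^ 4 by ring, hκc]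

end Summit.AtomisticToContinuum.FouriersLaw.Theorems.SubdiffusiveBondHeat

end
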